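import Literature.Analysis.FluidPDE.LocalPressureOscillationKernel
import Literature.Analysis.FluidPDE.CKNPressureCZ
import Literature.Analysis.FluidPDE.PressureIdentitySlicing
import Literature.Analysis.FluidPDE.PressureSliceDecay
import Literature.Analysis.FunctionSpaces.LpDualityTestFunctions
import HarnessLib

/-!
# The local pressure oscillation estimate on one time slice (Robinson–Rodrigo–Sadowski, Lemma 15.12)

Analysis/FluidPDE file (all results proved, no definitions, no named facts) in the discharge of
the named fact `Literature.Analysis.FluidPDE.RRS2016.lemma15_12` (`CKNLocalRegularityRRS.lean`;
J. C. Robinson, J. L. Rodrigo, W. Sadowski, *The three-dimensional Navier–Stokes equations* (2016),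
**Lemma 15.12**, pp. 232–234: the local pressure estimate, in the slice-wise form displayed on
p. 234,
`∫_{B_r} |p - (p)_r|^{3/2} ≤ c ∫_{B_{2r}} |u|³ + c r^{9/2} {∫_{2r<|y|<ρ} |u|²|y|⁻⁴ dy}^{3/2}
  + c (r/ρ)^{9/2} ∫_{B_ρ} (|u|³ + |p|^{3/2})`
for `p ∈ L^{3/2}(B_ρ)`, `u ∈ L³(B_ρ)` with `-Δp = ∂ᵢ∂ⱼ(uᵢuⱼ)` in `B_ρ` and `0 < r ≤ ρ/2`). This file
proves the **one-slice statement at unit scale `ρ = 1`** about an arbitrary centre `a`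
(`setLIntegral_pressure_oscillation_le_unitScale`); the general scale follows by dilation and the
space–time statement by slicing (`PressureIdentitySlicing.lean`), in sequel files.

## The proof (the printed argument with the Newtonian kernel on the test-function side)

The printed proof represents `φp` through the Newtonian potential of `Δ(φp)` and splits it into
five terms `p₁ + p_{2,1} + p_{2,2} + p_{3,1} + p_{3,2}` (p. 232), bounding `p_{1,1}` by the
Calderón–Zygmund theorem ((15.34)), and `p_{1,2}`, `p_{2,·}`, `p_{3,·}` through their gradients
and the mean value theorem ((15.35)–(15.37)). For a merely distributional solution `(u, p)` of the
pressure equation the same computation is carried out **by duality**, as in the tree's treatment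
of Lemarié-Rieusset's (13.20) and of RRS's Lemma 16.7 (`CKNPressureDuality.lean`,
`CKNPressureEstimate.lean`): for a test function `ψ ∈ C_c^∞(B_r(a))` the pressure equation is
tested with the truncated Newtonian potential `N[ψ] = Γ₀ ⋆ ψ` (radii `(1/8, 1/4)`,
`ΔN[ψ] = ψ - Λψ`, `NewtonLocalPotential.lean`), which gives
`∫ p ψ = ∫ p Λψ - ∫_{B_{2r}} D²N[ψ](u,u) - ∫_{B_1∖B_{2r}} D²N[ψ](u,u)`.
The middle term is the Calderón–Zygmund part (`p_{1,1}`): by the tree's theorem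
`stein1970_hessian_Lp_bound_holds_fin3` it is `≤ 9C₃ ‖ψ‖₃ ‖u‖²_{L³(B_{2r})}`
(`lintegral_hessian_newtonNearPotential_apply_le_of_isTestFunctionOn`). In the first and third
terms the kernels `λ(y - x)` and `D²Γ₀(y - x)` (`x ∈ B_r(a)`) are **frozen at the centre**
`x = a`: the frozen parts are `(∫ψ) · c` with a constant
`c = ∫_{B_1} p λ(· - a) - ∫_{B_1∖B_{2r}} ∂_u∂_uΓ₀(· - a)` independent of `ψ` — this is the
test-side counterpart of subtracting `p_i(0)` / the mean in (15.35)–(15.37) —, and the increments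
are `O(r)` by the Lipschitz bound for `λ` and the two-centre bound
`|D²Γ₀(y-x) - D²Γ₀(y-a)| ≤ C r |y-a|⁻⁴` (`LocalPressureOscillationKernel.lean`), giving
`|∫_{B_r} (p - c) ψ| ≤ L r ‖ψ‖₁ ∫_{B_1}|p| + 9C₃ ‖ψ‖₃ ‖u‖²_{L³(B_{2r})} + C_H r ‖ψ‖₁ ∫_{B_1∖B_{2r}} |u|²|y-a|⁻⁴`
(`abs_setIntegral_pressure_sub_const_mul_le`). With `‖ψ‖₁ ≤ |B_r|^{2/3} ‖ψ‖₃` this is a bound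
`K ‖ψ‖₃`, so the converse of Hölder's inequality
(`Literature.Analysis.FunctionSpaces.lintegral_rpow_enorm_le_of_forall_test`) yields
`∫_{B_r} |p - c|^{3/2} ≤ K^{3/2}`, and `(|B_r|^{2/3} r)^{3/2} = |B_1| r^{9/2}` produces exactly the
printed powers; finally the constant is replaced by the mean at the cost of a factor `4`
(`setLIntegral_rpow_sub_average_le_of_const`, RRS Exercise 15.2).

## Main statements

* `abs_setIntegral_pressure_sub_const_mul_le` — the bound for one test function;
* `setLIntegral_rpow_sub_average_le_of_const` — `∫_s |p - (p)_s|^{3/2} ≤ 4 ∫_s |p - c|^{3/2}`;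
* `setLIntegral_pressure_oscillation_le_unitScale` — Lemma 15.12 on one slice, `ρ = 1`.

## References

* J. C. Robinson, J. L. Rodrigo, W. Sadowski, *The three-dimensional Navier–Stokes equations*,
  Cambridge Studies in Advanced Mathematics 157 (2016): Lemma 15.12 and its proof, (15.32)–(15.37),
  pp. 232–234; Exercise 15.2. [RobinsonRodrigoSadowski2016]
* E. M. Stein, *Singular integrals and differentiability properties of functions* (1970),
  Ch. III §1.3, Prop. 3 (the Calderón–Zygmund input, proved in the tree). [Stein1971]
* D. Gilbarg, N. S. Trudinger, *Elliptic partial differential equations of second order* (2001),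
  (2.16)–(2.17), Lemma 4.1–4.2. [GilbargTrudinger2001]
-/

noncomputable section

open MeasureTheory Set Function Filter Topology TopologicalSpace Metric
open scoped ENNReal NNReal RealInnerProductSpace ContDiff Laplacian

namespace Literature.Analysis.FluidPDE

-- nested operator types `ℝ³ →L[ℝ] ℝ³ →L[ℝ] ℝ`
set_option maxSynthPendingDepth 3

variable {r₀ r₁ : ℝ}

/-! ### Supports of the truncated potential and of the smoothing of a test function -/

/-- If `tsupport ψ ⊆ B_r(a)` then `N[ψ]` (radii `r₀ < r₁`) vanishes off `B_{r + r₁}(a)`. [folklore] -/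
theorem newtonNearPotential_eq_zero_of_le_dist (h₀ : 0 ≤ r₀) (h₁ : r₀ < r₁)
    {ψ : EuclideanSpace ℝ (Fin 3) → ℝ} {a : EuclideanSpace ℝ (Fin 3)} {r : ℝ}
    (hsupp : tsupport ψ ⊆ ball a r) {x : EuclideanSpace ℝ (Fin 3)} (hx : r + r₁ ≤ ‖x - a‖) :
    newtonNearPotential r₀ r₁ ψ x = 0 := by
  refine newtonNearPotential_eq_zero_of_forall h₀ h₁ fun z hz => ?_
  by_contra hne
  have hmem : x - z ∈ ball a r := hsupp (subset_tsupport _ hne)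
  rw [mem_ball_iff_norm] at hmem
  have : ‖x - a‖ ≤ ‖x - z - a‖ + ‖z‖ := by
    calc ‖x - a‖ = ‖(x - z - a) + z‖ := by congr 1; abel
      _ ≤ ‖x - z - a‖ + ‖z‖ := norm_add_le _ _
  linarith

/-- If `tsupport ψ ⊆ B_r(a)` then `Λ[ψ]` (radii `r₀ < r₁`) vanishes off `B_{r + r₁}(a)`. [folklore] -/
theorem newtonFarSmoothing_eq_zero_of_le_dist (h₀ : 0 ≤ r₀) (h₁ : r₀ < r₁)
    {ψ : EuclideanSpace ℝ (Fin 3) → ℝ} {a : EuclideanSpace ℝ (Fin 3)} {r : ℝ}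
    (hsupp : tsupport ψ ⊆ ball a r) {x : EuclideanSpace ℝ (Fin 3)} (hx : r + r₁ ≤ ‖x - a‖) :
    newtonFarSmoothing r₀ r₁ ψ x = 0 := by
  refine newtonFarSmoothing_eq_zero_of_forall h₀ h₁ fun z hz => ?_
  by_contra hne
  have hmem : x - z ∈ ball a r := hsupp (subset_tsupport _ hne)
  rw [mem_ball_iff_norm] at hmem
  have : ‖x - a‖ ≤ ‖x - z - a‖ + ‖z‖ := by
    calc ‖x - a‖ = ‖(x - z - a) + z‖ := by congr 1; abel
      _ ≤ ‖x - z - a‖ + ‖z‖ := norm_add_le _ _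
  linarith

/-- If `tsupport ψ ⊆ B_r(a)` then `tsupport N[ψ] ⊆ B_R(a)` for every `R > r + r₁`. [folklore] -/
theorem tsupport_newtonNearPotential_subset_ball (h₀ : 0 ≤ r₀) (h₁ : r₀ < r₁)
    {ψ : EuclideanSpace ℝ (Fin 3) → ℝ} {a : EuclideanSpace ℝ (Fin 3)} {r R : ℝ}
    (hsupp : tsupport ψ ⊆ ball a r) (hR : r + r₁ < R) :
    tsupport (newtonNearPotential r₀ r₁ ψ) ⊆ ball a R := by
  have h1 : support (newtonNearPotential r₀ r₁ ψ) ⊆ closedBall a (r + r₁) := by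
    intro x hx
    rw [mem_closedBall_iff_norm]
    by_contra h
    exact hx (newtonNearPotential_eq_zero_of_le_dist h₀ h₁ hsupp (not_le.1 h).le)
  calc tsupport (newtonNearPotential r₀ r₁ ψ) ⊆ closedBall a (r + r₁) :=
        closure_minimal h1 isClosed_closedBall
    _ ⊆ ball a R := closedBall_subset_ball hR

/-! ### The smoothing of a test function with a frozen kernel -/

/-- **Freezing the smoothing kernel at the centre.** For a continuous compactly supported `ψ`
with `tsupport ψ ⊆ B_r(a)` and a Lipschitz constant `L` of `λ = newtonFarLaplacian r₀ r₁`,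
`|Λ[ψ](y) - λ(y - a) ∫ ψ| ≤ L r ∫ |ψ|` for every `y`
(`Λ[ψ](y) = ∫ ψ(x) λ(y - x) dx` and `|λ(y - x) - λ(y - a)| ≤ L|x - a| ≤ L r` on the support).
[folklore] -/
theorem abs_newtonFarSmoothing_sub_mul_integral_le {L : ℝ≥0}
    (hL : LipschitzWith L (newtonFarLaplacian r₀ r₁)) (h₀ : 0 < r₀) (h₁ : r₀ < r₁)
    {ψ : EuclideanSpace ℝ (Fin 3) → ℝ} (hψ : Continuous ψ) (hψc : HasCompactSupport ψ)
    {a : EuclideanSpace ℝ (Fin 3)} {r : ℝ} (hsupp : tsupport ψ ⊆ ball a r)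
    (y : EuclideanSpace ℝ (Fin 3)) :
    |newtonFarSmoothing r₀ r₁ ψ y - newtonFarLaplacian r₀ r₁ (y - a) * ∫ x, ψ x| ≤
      L * r * ∫ x, |ψ x| := by
  have hlamc : Continuous (newtonFarLaplacian r₀ r₁) := continuous_newtonFarLaplacian h₀ h₁
  have hint1 : Integrable (fun x => ψ x * newtonFarLaplacian r₀ r₁ (y - x)) :=
    ((hψ.mul (hlamc.comp (continuous_const.sub continuous_id))).integrable_of_hasCompactSupport
      hψc.mul_right)
  have hint2 : Integrable (fun x => ψ x * newtonFarLaplacian r₀ r₁ (y - a)) :=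
    (hψ.integrable_of_hasCompactSupport hψc).mul_const _
  have hrepr : newtonFarSmoothing r₀ r₁ ψ y - newtonFarLaplacian r₀ r₁ (y - a) * ∫ x, ψ x =
      ∫ x, ψ x * (newtonFarLaplacian r₀ r₁ (y - x) - newtonFarLaplacian r₀ r₁ (y - a)) := by
    rw [newtonFarSmoothing_eq_integral_kernel, mul_comm, ← integral_mul_const, ← integral_sub hint1 hint2]
    refine integral_congr_ae (Eventually.of_forall fun x => ?_)
    ring
  rw [hrepr]
  have hpt : ∀ x, |ψ x * (newtonFarLaplacian r₀ r₁ (y - x) - newtonFarLaplacian r₀ r₁ (y - a))| ≤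
      L * r * |ψ x| := by
    intro x
    by_cases hx : ψ x = 0
    · simp [hx]
    · have hxa : ‖x - a‖ < r := mem_ball_iff_norm.1 (hsupp (subset_tsupport _ hx))
      have hlip := hL.dist_le_mul (y - x) (y - a)
      rw [Real.dist_eq, dist_eq_norm, show y - x - (y - a) = a - x by abel, norm_sub_rev] at hlip
      rw [abs_mul]
      calc |ψ x| * |newtonFarLaplacian r₀ r₁ (y - x) - newtonFarLaplacian r₀ r₁ (y - a)|
          ≤ |ψ x| * (L * ‖x - a‖) := mul_le_mul_of_nonneg_left hlip (abs_nonneg _)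
        _ ≤ |ψ x| * (L * r) := by gcongr
        _ = L * r * |ψ x| := by ring
  calc |∫ x, ψ x * (newtonFarLaplacian r₀ r₁ (y - x) - newtonFarLaplacian r₀ r₁ (y - a))|
      ≤ ∫ x, |ψ x * (newtonFarLaplacian r₀ r₁ (y - x) - newtonFarLaplacian r₀ r₁ (y - a))| :=
        abs_integral_le_integral_abs
    _ ≤ ∫ x, L * r * |ψ x| := by
        refine integral_mono_of_nonneg (Eventually.of_forall fun x => abs_nonneg _)
          ((hψ.abs.integrable_of_hasCompactSupport hψc.abs).const_mul _)
          (Eventually.of_forall hpt)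
    _ = L * r * ∫ x, |ψ x| := integral_const_mul _ _

/-! ### The Hessian of the truncated potential far from the test function, with a frozen kernel -/

/-- **Freezing the Hessian kernel at the centre.** Let `C` be a two-centre constant for
`newtonNearHess r₀ r₁` (`exists_abs_newtonNearHess_sub_le`), `ψ` continuous with compact support,
`tsupport ψ ⊆ B_r(a)`, `r > 0`, and `2r ≤ |y - a|`. Then for every `v`,
`|D²N[ψ](y)(v,v) - ∂ᵥ∂ᵥΓ₀(y - a) ∫ ψ| ≤ (C r ‖v‖² / |y - a|⁴) ∫ |ψ|`
(`fderiv_fderiv_newtonNearPotential_eq_integral_of_far` and the two-centre bound on the support).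
[folklore] -/
theorem abs_fderiv_fderiv_newtonNearPotential_sub_mul_integral_le {C : ℝ}
    (hC : ∀ x₀ x y v : EuclideanSpace ℝ (Fin 3), 2 * ‖x - x₀‖ ≤ ‖y - x₀‖ → y ≠ x₀ →
      |newtonNearHess r₀ r₁ v v (y - x) - newtonNearHess r₀ r₁ v v (y - x₀)| ≤
        C * ‖x - x₀‖ * ‖v‖ ^ 2 / ‖y - x₀‖ ^ 4)
    (hC0 : 0 ≤ C) (h₀ : 0 < r₀) (h₁ : r₀ < r₁)
    {ψ : EuclideanSpace ℝ (Fin 3) → ℝ} (hψ : Continuous ψ) (hψc : HasCompactSupport ψ)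
    {a : EuclideanSpace ℝ (Fin 3)} {r : ℝ} (hr : 0 < r) (hsupp : tsupport ψ ⊆ ball a r)
    {y : EuclideanSpace ℝ (Fin 3)} (hy : 2 * r ≤ ‖y - a‖) (v : EuclideanSpace ℝ (Fin 3)) :
    |fderiv ℝ (fderiv ℝ (newtonNearPotential r₀ r₁ ψ)) y v v -
        newtonNearHess r₀ r₁ v v (y - a) * ∫ x, ψ x| ≤
      C * r * ‖v‖ ^ 2 / ‖y - a‖ ^ 4 * ∫ x, |ψ x| := by
  have hya : y ≠ a := by
    intro h
    rw [h, sub_self, norm_zero] at hy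
    linarith
  set B : ℝ := C * r * ‖v‖ ^ 2 / ‖y - a‖ ^ 4 with hBdef
  have hB0 : 0 ≤ B := by positivity
  rw [fderiv_fderiv_newtonNearPotential_eq_integral_of_far h₀ h₁ hψ hψc hr hsupp hy v]
  set H : EuclideanSpace ℝ (Fin 3) → ℝ := newtonNearHess r₀ r₁ v v with hHdef
  -- pointwise bound for the difference kernel on the support of `ψ`
  have hpt : ∀ x, |ψ x * (H (y - x) - H (y - a))| ≤ B * |ψ x| := by
    intro x
    by_cases hx : ψ x = 0
    · simp [hx]
    · have hxa : ‖x - a‖ < r := mem_ball_iff_norm.1 (hsupp (subset_tsupport _ hx))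
      have h2 : 2 * ‖x - a‖ ≤ ‖y - a‖ := by linarith
      have hk := hC a x y v h2 hya
      rw [abs_mul, mul_comm]
      refine mul_le_mul_of_nonneg_right (hk.trans ?_) (abs_nonneg _)
      rw [hBdef]
      gcongr
  -- integrability of the two pieces
  have hψi : Integrable ψ := hψ.integrable_of_hasCompactSupport hψc
  have hmeas : AEStronglyMeasurable (fun x => ψ x * (H (y - x) - H (y - a))) volume :=
    (hψ.measurable.mul (((measurable_newtonNearHess r₀ r₁ v v).comp
      (measurable_const.sub measurable_id)).sub measurable_const)).aestronglyMeasurable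
  have hdiff : Integrable (fun x => ψ x * (H (y - x) - H (y - a))) := by
    refine Integrable.mono' (hψi.abs.const_mul B) hmeas (Eventually.of_forall fun x => ?_)
    rw [Real.norm_eq_abs]
    exact hpt x
  have hconst : Integrable (fun x => ψ x * H (y - a)) := hψi.mul_const _
  have hsplit : (fun x => ψ x * H (y - x)) =
      fun x => ψ x * (H (y - x) - H (y - a)) + ψ x * H (y - a) := by
    funext x; ring
  have hrew : (∫ x, ψ x * H (y - x)) - H (y - a) * ∫ x, ψ x =
      ∫ x, ψ x * (H (y - x) - H (y - a)) := by
    rw [hsplit, integral_add hdiff hconst, integral_mul_const]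
    ring
  rw [hrew]
  calc |∫ x, ψ x * (H (y - x) - H (y - a))|
      ≤ ∫ x, |ψ x * (H (y - x) - H (y - a))| := abs_integral_le_integral_abs
    _ ≤ ∫ x, B * |ψ x| :=
        integral_mono_of_nonneg (Eventually.of_forall fun x => abs_nonneg _)
          (hψi.abs.const_mul B) (Eventually.of_forall hpt)
    _ = B * ∫ x, |ψ x| := integral_const_mul _ _

/-- Far beyond the support of `ψ` (`|y - a| > r + r₁`) the truncated potential has vanishing
Hessian. [folklore] -/
theorem fderiv_fderiv_newtonNearPotential_eq_zero_of_lt_dist (h₀ : 0 ≤ r₀) (h₁ : r₀ < r₁)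
    {ψ : EuclideanSpace ℝ (Fin 3) → ℝ} {a : EuclideanSpace ℝ (Fin 3)} {r : ℝ}
    (hsupp : tsupport ψ ⊆ ball a r) {y : EuclideanSpace ℝ (Fin 3)} (hy : r + r₁ < ‖y - a‖) :
    fderiv ℝ (fderiv ℝ (newtonNearPotential r₀ r₁ ψ)) y = 0 := by
  refine fderiv_fderiv_eq_zero_of_notMem_tsupport fun h => ?_
  have h' := tsupport_newtonNearPotential_subset_ball h₀ h₁ hsupp hy h
  rw [mem_ball_iff_norm] at h'
  exact lt_irrefl _ h'

/-! ### The Calderón–Zygmund bound for the Hessian pairing, spatial form -/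

/-- **Spatial Calderón–Zygmund bound for the Hessian pairing.** With a constant `C₃` for which
`‖∂ₐ∂_b N_{ρ/2,ρ}[g]‖_{L³} ≤ C₃ ‖g‖_{L³}` (`stein1970_hessian_Lp_bound.hessian_newtonNearPotential_half`),
a test function `g ∈ C_c^∞(B(x_B, R))` and fields `v, w` measurable on `B(x_B, R + ρ)`,
`∫ |D²N_{ρ/2,ρ}[g](v, w)| ≤ 9 C₃ ‖g‖_{L³} ‖|v||w|‖_{L^{3/2}(B(x_B,R+ρ))}` — the slice-wise lemma
`lintegral_hessian_newtonNearPotential_apply_le` applied to the space–time test function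
`η(t) g(x)` at a time with `η(t) = 1`. [cite: RobinsonRodrigoSadowski2016, proof of Lemma 15.12 p. 233 (bound for p₁₁)] -/
theorem lintegral_hessian_newtonNearPotential_apply_le_of_isTestFunctionOn {C₃ : ℝ≥0}
    (hC₃ : ∀ ⦃r : ℝ⦄, 0 < r → ∀ ⦃g : EuclideanSpace ℝ (Fin 3) → ℝ⦄, ContDiff ℝ 2 g →
      HasCompactSupport g → ∀ a b : EuclideanSpace ℝ (Fin 3), ‖a‖ ≤ 1 → ‖b‖ ≤ 1 →
        eLpNorm (fun x => fderiv ℝ (fun y => fderiv ℝ (newtonNearPotential (r / 2) r g) y a) x b)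
            3 volume ≤ C₃ * eLpNorm g 3 volume)
    {ρ R : ℝ} {xB : EuclideanSpace ℝ (Fin 3)} (hρ : 0 < ρ) {g : EuclideanSpace ℝ (Fin 3) → ℝ}
    (hg : FunctionSpaces.IsTestFunctionOn
      (⟨ball xB R, isOpen_ball⟩ : Opens (EuclideanSpace ℝ (Fin 3))) g)
    {v w : EuclideanSpace ℝ (Fin 3) → EuclideanSpace ℝ (Fin 3)}
    (hv : AEStronglyMeasurable v (volume.restrict (ball xB (R + ρ))))
    (hw : AEStronglyMeasurable w (volume.restrict (ball xB (R + ρ)))) :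
    ∫⁻ x, ‖fderiv ℝ (fderiv ℝ (newtonNearPotential (ρ / 2) ρ g)) x (v x) (w x)‖ₑ ≤
      9 * C₃ * (∫⁻ x, ‖g x‖ₑ ^ (3 : ℝ)) ^ (1 / 3 : ℝ) *
        (∫⁻ x in ball xB (R + ρ), (‖v x‖ₑ * ‖w x‖ₑ) ^ (3 / 2 : ℝ)) ^ (2 / 3 : ℝ) := by
  -- a time bump `η` with `η 0 = 1`, supported in `[-2, 2] ⊆ (-3, 3)`
  let η : ContDiffBump (0 : ℝ) := ⟨1, 2, one_pos, one_lt_two⟩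
  have hηs : tsupport (η : ℝ → ℝ) ⊆ Ioo (-3) 3 := by
    rw [η.tsupport_eq]
    intro t ht
    rw [mem_closedBall, dist_zero_right, Real.norm_eq_abs] at ht
    have h2 : |t| ≤ 2 := ht
    constructor <;> linarith [abs_le.1 h2]
  have hθ' : IsSpaceTimeTestOn (⟨Ioo (-3) 3 ×ˢ ball xB R, isOpen_Ioo.prod isOpen_ball⟩ :
      Opens (ℝ × EuclideanSpace ℝ (Fin 3))) (fun t x => η t * g x) :=
    isSpaceTimeTestOn_mul η.contDiff η.hasCompactSupport hηs hg
  have h := lintegral_hessian_newtonNearPotential_apply_le hC₃ hρ hθ' 0 hv hw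
  have h1 : (η : ℝ → ℝ) 0 = 1 := η.one_of_mem_closedBall (mem_closedBall_self zero_le_one)
  have h0 : (fun x => η 0 * g x) = g := by
    funext x
    rw [h1, one_mul]
  simpa only [h0, h1, one_mul] using h

/-! ### The tested identity with frozen constants: the bound for one test function -/

section OneTest

variable {a : EuclideanSpace ℝ (Fin 3)} {r : ℝ} {p : EuclideanSpace ℝ (Fin 3) → ℝ}
  {u : EuclideanSpace ℝ (Fin 3) → EuclideanSpace ℝ (Fin 3)}

/-- **The pressure minus the frozen constant, tested against one test function** (unit scale:
the duality step of the proof of Robinson–Rodrigo–Sadowski's Lemma 15.12, pp. 232–234, with the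
Newtonian kernel on the test-function side). Let `p ∈ L¹(B_1(a))`, `|u|² ∈ L¹(B_1(a))` (measurable
there) satisfy the pressure equation `∫ p Δφ = -∫ D²φ(u, u)` for every test function `φ` supported
in `B_1(a)`, let `0 < r ≤ 1/2`, and let `ψ ∈ C_c^∞(B_r(a))`. With the radii `(1/8, 1/4)` for the
truncated kernel `Γ₀`, the smoothing kernel `λ` and the potential `N[ψ]`, test the equation with
`N[ψ]` (`ΔN[ψ] = ψ - Λψ`): `∫ p ψ = ∫ p Λψ - ∫_{B_{2r}} D²N[ψ](u,u) - ∫_{B_1∖B_{2r}} D²N[ψ](u,u)`.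
Freezing the kernels of the first and third terms at the centre `a` produces the constant
`c = ∫_{B_1} p(y) λ(y - a) dy - ∫_{B_1∖B_{2r}} ∂_{u}∂_{u}Γ₀(y - a) dy` (independent of `ψ`) and
`|∫_{B_r} (p - c) ψ| ≤ L r ‖ψ‖₁ ∫_{B_1}|p| + 9 C₃ ‖ψ‖₃ ‖u‖²_{L³(B_{2r})} + C_H r ‖ψ‖₁ ∫_{B_1∖B_{2r}} |u|²|y-a|⁻⁴`
(`L` a Lipschitz constant of `λ`, `C_H` a two-centre constant of `∂²Γ₀`, `C₃` the Calderón–Zygmund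
constant). [cite: RobinsonRodrigoSadowski2016, proof of Lemma 15.12 pp. 232–234] -/
theorem abs_setIntegral_pressure_sub_const_mul_le {C₃ : ℝ≥0}
    (hC₃ : ∀ ⦃ρ : ℝ⦄, 0 < ρ → ∀ ⦃g : EuclideanSpace ℝ (Fin 3) → ℝ⦄, ContDiff ℝ 2 g →
      HasCompactSupport g → ∀ v w : EuclideanSpace ℝ (Fin 3), ‖v‖ ≤ 1 → ‖w‖ ≤ 1 →
        eLpNorm (fun x => fderiv ℝ (fun y => fderiv ℝ (newtonNearPotential (ρ / 2) ρ g) y v) x w)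
            3 volume ≤ C₃ * eLpNorm g 3 volume)
    {CH : ℝ} (hCH0 : 0 ≤ CH)
    (hCH : ∀ x₀ x y v : EuclideanSpace ℝ (Fin 3), 2 * ‖x - x₀‖ ≤ ‖y - x₀‖ → y ≠ x₀ →
      |newtonNearHess ((1 / 4 : ℝ) / 2) (1 / 4) v v (y - x) -
          newtonNearHess ((1 / 4 : ℝ) / 2) (1 / 4) v v (y - x₀)| ≤
        CH * ‖x - x₀‖ * ‖v‖ ^ 2 / ‖y - x₀‖ ^ 4)
    {L : ℝ≥0} (hL : LipschitzWith L (newtonFarLaplacian ((1 / 4 : ℝ) / 2) (1 / 4)))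
    (hr : 0 < r) (hr2 : r ≤ 1 / 2)
    (hum : AEStronglyMeasurable u (volume.restrict (ball a 1)))
    (hpi : IntegrableOn p (ball a 1) volume)
    (hu2 : IntegrableOn (fun x => ‖u x‖ ^ 2) (ball a 1) volume)
    (hu3 : ∫⁻ x in ball a 1, ‖u x‖ₑ ^ (3 : ℕ) < ⊤)
    (hid : ∀ φ : EuclideanSpace ℝ (Fin 3) → ℝ, ContDiff ℝ (⊤ : ℕ∞) φ → HasCompactSupport φ →
      tsupport φ ⊆ ball a 1 →
      ∫ x, p x * (Δ φ) x = -∫ x, fderiv ℝ (fderiv ℝ φ) x (u x) (u x))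
    {ψ : EuclideanSpace ℝ (Fin 3) → ℝ} (hψ : ContDiff ℝ (⊤ : ℕ∞) ψ) (hψc : HasCompactSupport ψ)
    (hψs : tsupport ψ ⊆ ball a r) :
    |∫ x in ball a r, (p x - ((∫ y in ball a 1, p y * newtonFarLaplacian ((1 / 4 : ℝ) / 2) (1 / 4) (y - a)) -
        ∫ y in ball a 1 \ ball a (2 * r),
          newtonNearHess ((1 / 4 : ℝ) / 2) (1 / 4) (u y) (u y) (y - a))) * ψ x| ≤
      (L * r * ∫ x, |ψ x|) * (∫ y in ball a 1, |p y|) +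
        (9 * C₃ * (∫⁻ x, ‖ψ x‖ₑ ^ (3 : ℝ)) ^ (1 / 3 : ℝ) *
          (∫⁻ x in ball a (2 * r), ‖u x‖ₑ ^ (3 : ℕ)) ^ (2 / 3 : ℝ)).toReal +
        (CH * r * ∫ x, |ψ x|) * ∫ y in ball a 1 \ ball a (2 * r), ‖u y‖ ^ 2 / ‖y - a‖ ^ 4 := by
  -- radii and kernels
  set ρN : ℝ := 1 / 4 with hρN
  have hρ0 : 0 < ρN := by norm_num
  have h₀ : 0 < ρN / 2 := by norm_num
  have h₁ : ρN / 2 < ρN := by norm_num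
  set lam : EuclideanSpace ℝ (Fin 3) → ℝ := newtonFarLaplacian (ρN / 2) ρN with hlam
  set N : EuclideanSpace ℝ (Fin 3) → ℝ := newtonNearPotential (ρN / 2) ρN ψ with hN
  set Λψ : EuclideanSpace ℝ (Fin 3) → ℝ := newtonFarSmoothing (ρN / 2) ρN ψ with hΛ
  set B₁ : Set (EuclideanSpace ℝ (Fin 3)) := ball a 1 with hB₁
  set B₂ : Set (EuclideanSpace ℝ (Fin 3)) := ball a (2 * r) with hB₂
  set Sψ : ℝ := ∫ x, ψ x with hSψ
  set Iψ : ℝ := ∫ x, |ψ x| with hIψ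
  -- the test function `N[ψ]`
  have hψ2 : ContDiff ℝ 2 ψ := contDiff_infty.1 hψ 2
  have hψcont : Continuous ψ := hψ.continuous
  have hNs : ContDiff ℝ (⊤ : ℕ∞) N := contDiff_newtonNearPotential_top h₀.le h₁ hψ
  have hNc : HasCompactSupport N := hasCompactSupport_newtonNearPotential h₀.le h₁ hψc
  have hNsupp : tsupport N ⊆ B₁ :=
    tsupport_newtonNearPotential_subset_ball h₀.le h₁ hψs (by rw [hρN]; linarith)
  have hN2 : ContDiff ℝ 2 N := contDiff_infty.1 hNs 2
  -- its Laplacian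
  have hΔN : ∀ x, Δ N x = ψ x - Λψ x := fun x => laplacian_newtonNearPotential h₀ h₁ hψ2 x
  -- continuity, boundedness and supports of `ψ`, `Λψ`, `lam`
  have hlamc : Continuous lam := continuous_newtonFarLaplacian h₀ h₁
  have hΛcont : Continuous Λψ := continuous_newtonFarSmoothing h₀ h₁ hψcont
  have hΛc : HasCompactSupport Λψ := hasCompactSupport_newtonFarSmoothing h₀.le h₁ hψc
  have hψ0 : ∀ x, x ∉ ball a r → ψ x = 0 := fun x hx =>
    image_eq_zero_of_notMem_tsupport fun h => hx (hψs h)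
  have hψ0' : ∀ x, x ∉ B₁ → ψ x = 0 := fun x hx =>
    hψ0 x fun h => hx (ball_subset_ball (by linarith) h)
  have hΛ0 : ∀ x, x ∉ B₁ → Λψ x = 0 := by
    intro x hx
    rw [hB₁, mem_ball_iff_norm, not_lt] at hx
    exact newtonFarSmoothing_eq_zero_of_le_dist h₀.le h₁ hψs (by rw [hρN]; linarith)
  obtain ⟨Mψ, hMψ⟩ := hψcont.bounded_above_of_compact_support hψc
  obtain ⟨MΛ, hMΛ⟩ := hΛcont.bounded_above_of_compact_support hΛc
  obtain ⟨Mlam, hMlam⟩ := hlamc.bounded_above_of_compact_support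
    (hasCompactSupport_newtonFarLaplacian h₀.le h₁)
  have hψi : Integrable ψ := hψcont.integrable_of_hasCompactSupport hψc
  -- integrability of `p ψ`, `p Λψ`, `p lam(· - a)` on `B₁`
  have hpψ : IntegrableOn (fun x => p x * ψ x) B₁ volume := by
    have := hpi.bdd_mul (hψcont.aestronglyMeasurable) (Eventually.of_forall hMψ)
    simpa only [IntegrableOn, mul_comm] using this
  have hpΛ : IntegrableOn (fun x => p x * Λψ x) B₁ volume := by
    have := hpi.bdd_mul (hΛcont.aestronglyMeasurable) (Eventually.of_forall hMΛ)
    simpa only [IntegrableOn, mul_comm] using this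
  have hlamac : Continuous fun x : EuclideanSpace ℝ (Fin 3) => lam (x - a) :=
    hlamc.comp (continuous_id.sub continuous_const)
  have hplam : IntegrableOn (fun x => p x * lam (x - a)) B₁ volume := by
    have := hpi.bdd_mul hlamac.aestronglyMeasurable (Eventually.of_forall fun x => hMlam (x - a))
    simpa only [IntegrableOn, mul_comm] using this
  -- ### Step 1: the tested identity `∫_{B₁} p ψ = ∫_{B₁} p Λψ - ∫_{B₁} D²N(u,u)`
  have hidN := hid N hNs hNc hNsupp
  have hD2N0 : ∀ x, x ∉ B₁ → fderiv ℝ (fderiv ℝ N) x = 0 := fun x hx =>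
    fderiv_fderiv_eq_zero_of_notMem_tsupport fun h => hx (hNsupp h)
  have hΔN0 : ∀ x, x ∉ B₁ → Δ N x = 0 := fun x hx =>
    FluidPDE.laplacian_eq_zero_of_notMem_tsupport fun h => hx (hNsupp h)
  have hstep1 : ∫ x in B₁, p x * ψ x =
      (∫ x in B₁, p x * Λψ x) - ∫ x in B₁, fderiv ℝ (fderiv ℝ N) x (u x) (u x) := by
    have e1 : ∫ x, p x * Δ N x = ∫ x in B₁, p x * Δ N x :=
      (setIntegral_eq_integral_of_forall_compl_eq_zero fun x hx => by
        rw [hΔN0 x hx, mul_zero]).symm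
    have e2 : ∫ x, fderiv ℝ (fderiv ℝ N) x (u x) (u x) =
        ∫ x in B₁, fderiv ℝ (fderiv ℝ N) x (u x) (u x) :=
      (setIntegral_eq_integral_of_forall_compl_eq_zero fun x hx => by
        rw [hD2N0 x hx]; rfl).symm
    have e3 : ∫ x in B₁, p x * Δ N x = (∫ x in B₁, p x * ψ x) - ∫ x in B₁, p x * Λψ x := by
      rw [← integral_sub hpψ hpΛ]
      refine integral_congr_ae (Eventually.of_forall fun x => ?_)
      show p x * Δ N x = p x * ψ x - p x * Λψ x
      rw [hΔN x]
      ring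
    rw [e1, e2, e3] at hidN
    linarith
  -- ### Step 2: the smoothing term with the frozen kernel
  have hDlam : ∀ y, |Λψ y - lam (y - a) * Sψ| ≤ L * r * Iψ := fun y =>
    abs_newtonFarSmoothing_sub_mul_integral_le hL h₀ h₁ hψcont hψc hψs y
  have hstep2 : |(∫ y in B₁, p y * Λψ y) - Sψ * ∫ y in B₁, p y * lam (y - a)| ≤
      (L * r * Iψ) * ∫ y in B₁, |p y| := by
    have e1 : (∫ y in B₁, p y * Λψ y) - Sψ * ∫ y in B₁, p y * lam (y - a) =
        ∫ y in B₁, p y * (Λψ y - lam (y - a) * Sψ) := by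
      rw [← integral_const_mul, ← integral_sub hpΛ (hplam.const_mul Sψ)]
      refine integral_congr_ae (Eventually.of_forall fun y => ?_)
      ring
    rw [e1]
    calc |∫ y in B₁, p y * (Λψ y - lam (y - a) * Sψ)|
        ≤ ∫ y in B₁, |p y * (Λψ y - lam (y - a) * Sψ)| := abs_integral_le_integral_abs
      _ ≤ ∫ y in B₁, (L * r * Iψ) * |p y| := by
          refine integral_mono_of_nonneg (Eventually.of_forall fun y => abs_nonneg _)
            (hpi.abs.const_mul _) (Eventually.of_forall fun y => ?_)
          dsimp only
          rw [abs_mul, mul_comm]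
          exact mul_le_mul_of_nonneg_right (hDlam y) (abs_nonneg _)
      _ = (L * r * Iψ) * ∫ y in B₁, |p y| := integral_const_mul _ _
  -- ### Step 3: the Hessian term, split into `B₁ ∩ B₂` and `B₁ ∖ B₂`
  set f : EuclideanSpace ℝ (Fin 3) → ℝ := fun x => fderiv ℝ (fderiv ℝ N) x (u x) (u x) with hf
  have hHc : Continuous (fderiv ℝ (fderiv ℝ N)) :=
    (hN2.fderiv_right (m := 1) (by norm_num)).continuous_fderiv one_ne_zero
  have hK78 : tsupport N ⊆ ball a (7 / 8) :=
    tsupport_newtonNearPotential_subset_ball h₀.le h₁ hψs (by rw [hρN]; linarith)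
  have hKB₁ : closedBall a (7 / 8) ⊆ B₁ := closedBall_subset_ball (by norm_num)
  have hfint : Integrable f := by
    refine integrable_bilin_apply_self_of_eq_zero_off_compact (isCompact_closedBall a (7 / 8)) hHc
      (fun x hx => fderiv_fderiv_eq_zero_of_notMem_tsupport fun h =>
        hx (ball_subset_closedBall (hK78 h)))
      (hum.mono_measure (Measure.restrict_mono hKB₁ le_rfl)) (hu2.mono_set hKB₁)
  have hfB₁ : IntegrableOn f B₁ volume := hfint.integrableOn
  have hsplit : ∫ x in B₁, f x = (∫ x in B₁ ∩ B₂, f x) + ∫ x in B₁ \ B₂, f x :=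
    (integral_inter_add_sdiff measurableSet_ball hfB₁).symm
  -- ### Step 3a: the near part by Calderón–Zygmund
  set u₂ : EuclideanSpace ℝ (Fin 3) → EuclideanSpace ℝ (Fin 3) := (B₁ ∩ B₂).indicator u with hu₂
  have hmeasBB : MeasurableSet (B₁ ∩ B₂) := measurableSet_ball.inter measurableSet_ball
  have hind : ∀ x, fderiv ℝ (fderiv ℝ N) x (u₂ x) (u₂ x) = (B₁ ∩ B₂).indicator f x := by
    intro x
    by_cases hx : x ∈ B₁ ∩ B₂
    · simp only [hu₂, hf, indicator_of_mem hx]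
    · simp only [hu₂, hf, indicator_of_notMem hx, map_zero]
  have hnear_eq : ∫ x in B₁ ∩ B₂, f x = ∫ x, fderiv ℝ (fderiv ℝ N) x (u₂ x) (u₂ x) := by
    simp_rw [hind]
    rw [integral_indicator hmeasBB]
  have hsubB : ball a (r + ρN) ⊆ B₁ := ball_subset_ball (by rw [hρN]; linarith)
  have hu₂m : AEStronglyMeasurable u₂ (volume.restrict (ball a (r + ρN))) :=
    (hum.mono_measure (Measure.restrict_mono hsubB le_rfl)).indicator hmeasBB
  have hCZ := lintegral_hessian_newtonNearPotential_apply_le_of_isTestFunctionOn hC₃ hρ0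
    (⟨hψ, hψc, hψs⟩ : FunctionSpaces.IsTestFunctionOn
      (⟨ball a r, isOpen_ball⟩ : Opens (EuclideanSpace ℝ (Fin 3))) ψ) hu₂m hu₂m
  -- `(‖u₂‖ ‖u₂‖)^{3/2}` is the indicator of `‖u‖³`
  have hind3 : ∀ x, (‖u₂ x‖ₑ * ‖u₂ x‖ₑ) ^ (3 / 2 : ℝ) =
      (B₁ ∩ B₂).indicator (fun x => ‖u x‖ₑ ^ (3 : ℕ)) x := by
    intro x
    have e3 : ∀ y : ℝ≥0∞, (y * y) ^ (3 / 2 : ℝ) = y ^ (3 : ℕ) := fun y => by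
      rw [← pow_two, ← ENNReal.rpow_natCast, ← ENNReal.rpow_mul]
      norm_num
    by_cases hx : x ∈ B₁ ∩ B₂
    · simp only [hu₂, indicator_of_mem hx, e3]
    · simp only [hu₂, indicator_of_notMem hx, enorm_zero, mul_zero,
        ENNReal.zero_rpow_of_pos (by norm_num : (0 : ℝ) < 3 / 2)]
  have hU : ∫⁻ x in ball a (r + ρN), (‖u₂ x‖ₑ * ‖u₂ x‖ₑ) ^ (3 / 2 : ℝ) ≤
      ∫⁻ x in B₂, ‖u x‖ₑ ^ (3 : ℕ) := by
    simp_rw [hind3]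
    rw [lintegral_indicator hmeasBB, Measure.restrict_restrict hmeasBB]
    exact lintegral_mono_set (inter_subset_left.trans inter_subset_right)
  have hUtop : ∫⁻ x in B₂, ‖u x‖ₑ ^ (3 : ℕ) ≠ ⊤ :=
    ((lintegral_mono_set (ball_subset_ball (by linarith) : B₂ ⊆ B₁)).trans_lt hu3).ne
  have hnear : |∫ x in B₁ ∩ B₂, f x| ≤
      (9 * C₃ * (∫⁻ x, ‖ψ x‖ₑ ^ (3 : ℝ)) ^ (1 / 3 : ℝ) *
        (∫⁻ x in B₂, ‖u x‖ₑ ^ (3 : ℕ)) ^ (2 / 3 : ℝ)).toReal := by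
    rw [hnear_eq, ← Real.norm_eq_abs]
    refine (norm_integral_le_lintegral_norm _).trans (ENNReal.toReal_mono ?_ ?_)
    · refine ENNReal.mul_ne_top (ENNReal.mul_ne_top (by simp [ENNReal.mul_ne_top]) ?_)
        (ENNReal.rpow_ne_top_of_nonneg (by norm_num) hUtop)
      refine ENNReal.rpow_ne_top_of_nonneg (by norm_num) ?_
      have : MemLp ψ 3 volume := hψcont.memLp_of_hasCompactSupport hψc
      have h3 := this.eLpNorm_lt_top
      rw [eLpNorm_eq_lintegral_rpow_enorm_toReal (by norm_num) (by norm_num), ENNReal.toReal_ofNat,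
        one_div] at h3
      exact (ENNReal.rpow_lt_top_iff_of_pos (by norm_num)).1 h3 |>.ne
    · simp_rw [ofReal_norm]
      refine hCZ.trans ?_
      gcongr
  -- ### Step 3b: the far part with the frozen kernel
  set Γ₀ : EuclideanSpace ℝ (Fin 3) → ℝ := newtonNear (ρN / 2) ρN with hΓ₀
  set Θ : EuclideanSpace ℝ (Fin 3) → EuclideanSpace ℝ (Fin 3) →L[ℝ] EuclideanSpace ℝ (Fin 3) →L[ℝ] ℝ :=
    fun y => fderiv ℝ (fderiv ℝ Γ₀) (y - a) with hΘ
  have hΘeq : ∀ y v, newtonNearHess (ρN / 2) ρN v v (y - a) = Θ y v v := fun y v => rfl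
  set D : Set (EuclideanSpace ℝ (Fin 3)) := B₁ \ B₂ with hD
  have hDm : MeasurableSet D := measurableSet_ball.diff measurableSet_ball
  have hDfar : ∀ y ∈ D, 2 * r ≤ ‖y - a‖ := fun y hy => by
    have h2 : y ∉ ball a (2 * r) := hy.2
    rwa [mem_ball_iff_norm, not_lt] at h2
  have hDpos : ∀ y ∈ D, 0 < ‖y - a‖ := fun y hy => by linarith [hDfar y hy]
  -- integrability of `Θ(u,u)` on `D`
  obtain ⟨C₂, hC₂0, hC₂⟩ := exists_norm_fderiv2_newtonNear_le h₀ h₁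
  have hΘm : AEStronglyMeasurable Θ (volume.restrict D) := by
    have hmeas : Measurable (fderiv ℝ (fderiv ℝ Γ₀)) := measurable_fderiv ℝ (fderiv ℝ Γ₀)
    exact (hmeas.comp (measurable_id.sub measurable_const)).aestronglyMeasurable
  have humD : AEStronglyMeasurable u (volume.restrict D) :=
    hum.mono_measure (Measure.restrict_mono sdiff_subset le_rfl)
  have hu2D : IntegrableOn (fun y => ‖u y‖ ^ 2) D volume := hu2.mono_set sdiff_subset
  have hΘbd : ∀ y ∈ D, ‖Θ y‖ ≤ C₂ * (2 * r) ^ (-(3 : ℝ)) := by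
    intro y hy
    have hne : y - a ≠ 0 := norm_pos_iff.1 (hDpos y hy)
    refine (hC₂ (y - a) hne).trans ?_
    exact mul_le_mul_of_nonneg_left
      (Real.rpow_le_rpow_of_nonpos (by positivity) (hDfar y hy) (by norm_num)) hC₂0
  have hΘint : IntegrableOn (fun y => Θ y (u y) (u y)) D volume := by
    refine Integrable.mono' (hu2D.const_mul (C₂ * (2 * r) ^ (-(3 : ℝ))))
      (aestronglyMeasurable_bilin_apply_self hΘm humD) ?_
    filter_upwards [ae_restrict_mem hDm] with y hy
    calc ‖Θ y (u y) (u y)‖ ≤ ‖Θ y‖ * ‖u y‖ * ‖u y‖ := (Θ y).le_opNorm₂ _ _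
      _ = ‖Θ y‖ * ‖u y‖ ^ 2 := by ring
      _ ≤ C₂ * (2 * r) ^ (-(3 : ℝ)) * ‖u y‖ ^ 2 :=
          mul_le_mul_of_nonneg_right (hΘbd y hy) (sq_nonneg _)
  -- the weight `|u|² |y - a|⁻⁴` is integrable on `D`
  have hWint : IntegrableOn (fun y => ‖u y‖ ^ 2 / ‖y - a‖ ^ 4) D volume := by
    have hcont : ContinuousOn (fun y : EuclideanSpace ℝ (Fin 3) => (‖y - a‖ ^ 4)⁻¹) D := by
      refine ContinuousOn.inv₀ (by fun_prop) fun y hy => ?_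
      exact (pow_pos (hDpos y hy) 4).ne'
    have hbd : ∀ᵐ y ∂(volume.restrict D), ‖(‖y - a‖ ^ 4)⁻¹‖ ≤ ((2 * r) ^ 4)⁻¹ := by
      filter_upwards [ae_restrict_mem hDm] with y hy
      rw [norm_inv, norm_pow, norm_norm]
      exact inv_anti₀ (by positivity) (pow_le_pow_left₀ (by positivity) (hDfar y hy) 4)
    have h := hu2D.bdd_mul (hcont.aestronglyMeasurable hDm) hbd
    refine (h.congr (Eventually.of_forall fun y => ?_))
    simp only [div_eq_mul_inv, mul_comm]
  -- the remainder on `D`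
  have hrest_pt : ∀ y ∈ D, |f y - Θ y (u y) (u y) * Sψ| ≤
      (CH * r * Iψ) * (‖u y‖ ^ 2 / ‖y - a‖ ^ 4) := by
    intro y hy
    have h := abs_fderiv_fderiv_newtonNearPotential_sub_mul_integral_le hCH hCH0 h₀ h₁ hψcont hψc
      hr hψs (hDfar y hy) (u y)
    rw [hΘeq] at h
    refine h.trans (le_of_eq ?_)
    rw [hIψ]
    field_simp
  have hrest_int : IntegrableOn (fun y => f y - Θ y (u y) (u y) * Sψ) D volume :=
    (hfB₁.mono_set sdiff_subset).sub (hΘint.mul_const _)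
  have hfar_eq : ∫ y in D, f y = Sψ * (∫ y in D, Θ y (u y) (u y)) +
      ∫ y in D, (f y - Θ y (u y) (u y) * Sψ) := by
    rw [← integral_const_mul, ← integral_add (hΘint.const_mul _) hrest_int]
    refine integral_congr_ae (Eventually.of_forall fun y => ?_)
    ring
  have hfar : |(∫ y in D, f y) - Sψ * ∫ y in D, Θ y (u y) (u y)| ≤
      (CH * r * Iψ) * ∫ y in D, ‖u y‖ ^ 2 / ‖y - a‖ ^ 4 := by
    rw [hfar_eq, add_sub_cancel_left]
    calc |∫ y in D, (f y - Θ y (u y) (u y) * Sψ)|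
        ≤ ∫ y in D, |f y - Θ y (u y) (u y) * Sψ| := abs_integral_le_integral_abs
      _ ≤ ∫ y in D, (CH * r * Iψ) * (‖u y‖ ^ 2 / ‖y - a‖ ^ 4) := by
          refine integral_mono_ae hrest_int.abs (hWint.const_mul _) ?_
          filter_upwards [ae_restrict_mem hDm] with y hy
          exact hrest_pt y hy
      _ = (CH * r * Iψ) * ∫ y in D, ‖u y‖ ^ 2 / ‖y - a‖ ^ 4 := integral_const_mul _ _
  -- ### Step 4: the left-hand side and the collection of the three bounds
  set clam : ℝ := ∫ y in B₁, p y * lam (y - a) with hclam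
  set cH : ℝ := ∫ y in D, Θ y (u y) (u y) with hcH
  have hcHeq : (∫ y in D, newtonNearHess (ρN / 2) ρN (u y) (u y) (y - a)) = cH := by
    rw [hcH]
    exact integral_congr_ae (Eventually.of_forall fun y => hΘeq y (u y))
  have hLHS : ∫ x in ball a r, (p x - (clam - cH)) * ψ x =
      (∫ x in B₁, p x * ψ x) - (clam - cH) * Sψ := by
    have hpr : IntegrableOn (fun x => p x * ψ x) (ball a r) volume :=
      hpψ.mono_set (ball_subset_ball (by linarith))
    have hcr : IntegrableOn (fun x => (clam - cH) * ψ x) (ball a r) volume :=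
      (hψi.const_mul _).integrableOn
    have e0 : ∀ x, (p x - (clam - cH)) * ψ x = p x * ψ x - (clam - cH) * ψ x := fun x => by ring
    simp_rw [e0]
    rw [integral_sub hpr hcr, integral_const_mul]
    have e1 : ∫ x in ball a r, p x * ψ x = ∫ x, p x * ψ x :=
      setIntegral_eq_integral_of_forall_compl_eq_zero fun x hx => by rw [hψ0 x hx, mul_zero]
    have e2 : ∫ x in B₁, p x * ψ x = ∫ x, p x * ψ x :=
      setIntegral_eq_integral_of_forall_compl_eq_zero fun x hx => by rw [hψ0' x hx, mul_zero]
    have e3 : ∫ x in ball a r, ψ x = ∫ x, ψ x :=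
      setIntegral_eq_integral_of_forall_compl_eq_zero fun x hx => hψ0 x hx
    rw [e1, ← e2, e3]
  rw [hcHeq, hLHS, hstep1, hsplit]
  -- `∫ pψ - c Sψ = (∫ pΛ - Sψ clam) - near - (far - Sψ cH)`
  have halg : (∫ x in B₁, p x * Λψ x) - ((∫ x in B₁ ∩ B₂, f x) + ∫ x in D, f x) - (clam - cH) * Sψ =
      ((∫ x in B₁, p x * Λψ x) - Sψ * clam) - (∫ x in B₁ ∩ B₂, f x) -
        ((∫ x in D, f x) - Sψ * cH) := by ring
  rw [halg]
  calc |((∫ x in B₁, p x * Λψ x) - Sψ * clam) - (∫ x in B₁ ∩ B₂, f x) -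
          ((∫ x in D, f x) - Sψ * cH)|
      ≤ |(∫ x in B₁, p x * Λψ x) - Sψ * clam| + |∫ x in B₁ ∩ B₂, f x| +
          |(∫ x in D, f x) - Sψ * cH| := by
        refine (abs_sub _ _).trans ?_
        gcongr
        exact abs_sub _ _
    _ ≤ _ := add_le_add_three hstep2 hnear hfar

end OneTest

/-! ### Replacing a constant by the mean -/

/-- **The mean is a nearly optimal constant in `L^{3/2}`:** for `p` integrable on a set `s` of
finite positive measure and every constant `c`,
`∫_s |p - (p)_s|^{3/2} ≤ 4 ∫_s |p - c|^{3/2}` (`(p)_s - c = ⨍_s (p - c)`, Jensen/Hölder for the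
average, and `|α + β|^{3/2} ≤ 2^{1/2}(|α|^{3/2} + |β|^{3/2})`; Robinson–Rodrigo–Sadowski,
Exercise 15.2: `‖(p)_r‖_{L^q(B_r)} ≤ ‖p‖_{L^q(B_r)}`). [folklore] -/
theorem setLIntegral_rpow_sub_average_le_of_const {s : Set (EuclideanSpace ℝ (Fin 3))}
    (hs0 : volume s ≠ 0) (hst : volume s ≠ ⊤) {p : EuclideanSpace ℝ (Fin 3) → ℝ}
    (hp : IntegrableOn p s volume) (c : ℝ) :
    ∫⁻ x in s, ‖p x - ⨍ y in s, p y‖ₑ ^ (3 / 2 : ℝ) ≤ 4 * ∫⁻ x in s, ‖p x - c‖ₑ ^ (3 / 2 : ℝ) := by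
  set m : ℝ := ⨍ y in s, p y with hm
  set A : ℝ≥0∞ := volume s with hA
  haveI : IsFiniteMeasure (volume.restrict s) := ⟨by rwa [Measure.restrict_apply_univ, lt_top_iff_ne_top]⟩
  have hreal : volume.real s = A.toReal := rfl
  have hreal0 : 0 < volume.real s := by
    rw [hreal]; exact ENNReal.toReal_pos hs0 hst
  have hpc : IntegrableOn (fun y => p y - c) s volume := hp.sub (integrableOn_const hst)
  -- `m - c = ⨍_s (p - c)`
  have hmc : m - c = (volume.real s)⁻¹ * ∫ y in s, (p y - c) := by
    rw [hm, setAverage_eq, smul_eq_mul, integral_sub hp (integrableOn_const hst),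
      setIntegral_const, smul_eq_mul]
    field_simp
  -- `‖m - c‖ₑ ≤ A⁻¹ ∫⁻_s ‖p - c‖ₑ`
  have hmc' : ‖m - c‖ₑ ≤ A⁻¹ * ∫⁻ y in s, ‖p y - c‖ₑ := by
    rw [hmc, enorm_mul, ← ofReal_norm (∫ y in s, (p y - c)),
      ← ofReal_integral_norm_eq_lintegral_enorm hpc]
    have e1 : ‖(volume.real s)⁻¹‖ₑ = A⁻¹ := by
      rw [Real.enorm_eq_ofReal (inv_nonneg.2 hreal0.le), hreal, ENNReal.ofReal_inv_of_pos
        (by rw [← hreal]; exact hreal0), ENNReal.ofReal_toReal hst]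
    rw [e1]
    gcongr
    exact norm_integral_le_integral_norm _
  -- `∫⁻_s ‖m - c‖ₑ^{3/2} ≤ ∫⁻_s ‖p - c‖ₑ^{3/2}`
  have hconst : ∫⁻ _x in s, ‖m - c‖ₑ ^ (3 / 2 : ℝ) ≤ ∫⁻ x in s, ‖p x - c‖ₑ ^ (3 / 2 : ℝ) := by
    rw [setLIntegral_const, mul_comm]
    have hH := lintegral_enorm_rpow_threeHalves_le (μ := volume.restrict s) (h := fun y => p y - c)
      hpc.aestronglyMeasurable
    rw [Measure.restrict_apply_univ] at hH
    calc A * ‖m - c‖ₑ ^ (3 / 2 : ℝ)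
        ≤ A * (A⁻¹ * ∫⁻ y in s, ‖p y - c‖ₑ) ^ (3 / 2 : ℝ) := by gcongr
      _ = A * (A⁻¹) ^ (3 / 2 : ℝ) * (∫⁻ y in s, ‖p y - c‖ₑ) ^ (3 / 2 : ℝ) := by
          rw [ENNReal.mul_rpow_of_nonneg _ _ (by norm_num), mul_assoc]
      _ ≤ A * (A⁻¹) ^ (3 / 2 : ℝ) * (A ^ (1 / 2 : ℝ) * ∫⁻ y in s, ‖p y - c‖ₑ ^ (3 / 2 : ℝ)) := by
          gcongr
      _ = (A * (A⁻¹) ^ (3 / 2 : ℝ) * A ^ (1 / 2 : ℝ)) * ∫⁻ y in s, ‖p y - c‖ₑ ^ (3 / 2 : ℝ) := by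
          ring
      _ = ∫⁻ y in s, ‖p y - c‖ₑ ^ (3 / 2 : ℝ) := by
          have hA32 : A ^ (3 / 2 : ℝ) ≠ 0 := (ENNReal.rpow_pos (pos_iff_ne_zero.2 hs0) hst).ne'
          have hA32t : A ^ (3 / 2 : ℝ) ≠ ⊤ := ENNReal.rpow_ne_top_of_nonneg (by norm_num) hst
          have e : A * (A⁻¹) ^ (3 / 2 : ℝ) * A ^ (1 / 2 : ℝ) = 1 := by
            calc A * (A⁻¹) ^ (3 / 2 : ℝ) * A ^ (1 / 2 : ℝ)
                = (A ^ (1 : ℝ) * A ^ (1 / 2 : ℝ)) * (A ^ (3 / 2 : ℝ))⁻¹ := by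
                  rw [ENNReal.inv_rpow, ENNReal.rpow_one]; ring
              _ = A ^ (3 / 2 : ℝ) * (A ^ (3 / 2 : ℝ))⁻¹ := by
                  rw [← ENNReal.rpow_add _ _ hs0 hst]; norm_num
              _ = 1 := ENNReal.mul_inv_cancel hA32 hA32t
          rw [e, one_mul]
  -- pointwise splitting and integration
  have hpt : ∀ x, ‖p x - m‖ₑ ^ (3 / 2 : ℝ) ≤
      2 * (‖p x - c‖ₑ ^ (3 / 2 : ℝ) + ‖m - c‖ₑ ^ (3 / 2 : ℝ)) := by
    intro x
    have h1 : ‖p x - m‖ₑ ≤ ‖p x - c‖ₑ + ‖m - c‖ₑ := by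
      calc ‖p x - m‖ₑ = ‖(p x - c) - (m - c)‖ₑ := by congr 1; ring
        _ ≤ ‖p x - c‖ₑ + ‖m - c‖ₑ := enorm_sub_le
    calc ‖p x - m‖ₑ ^ (3 / 2 : ℝ) ≤ (‖p x - c‖ₑ + ‖m - c‖ₑ) ^ (3 / 2 : ℝ) :=
          ENNReal.rpow_le_rpow h1 (by norm_num)
      _ ≤ 2 ^ ((3 / 2 : ℝ) - 1) * (‖p x - c‖ₑ ^ (3 / 2 : ℝ) + ‖m - c‖ₑ ^ (3 / 2 : ℝ)) :=
          ENNReal.rpow_add_le_mul_rpow_add_rpow _ _ (by norm_num)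
      _ ≤ 2 * (‖p x - c‖ₑ ^ (3 / 2 : ℝ) + ‖m - c‖ₑ ^ (3 / 2 : ℝ)) := by
          gcongr
          calc (2 : ℝ≥0∞) ^ ((3 / 2 : ℝ) - 1) ≤ 2 ^ (1 : ℝ) :=
                ENNReal.rpow_le_rpow_of_exponent_le (by norm_num) (by norm_num)
            _ = 2 := ENNReal.rpow_one _
  calc ∫⁻ x in s, ‖p x - m‖ₑ ^ (3 / 2 : ℝ)
      ≤ ∫⁻ x in s, 2 * (‖p x - c‖ₑ ^ (3 / 2 : ℝ) + ‖m - c‖ₑ ^ (3 / 2 : ℝ)) := lintegral_mono fun x => hpt x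
    _ = 2 * ((∫⁻ x in s, ‖p x - c‖ₑ ^ (3 / 2 : ℝ)) + ∫⁻ _x in s, ‖m - c‖ₑ ^ (3 / 2 : ℝ)) := by
        rw [lintegral_const_mul' _ _ ENNReal.ofNat_ne_top, lintegral_add_right _ measurable_const]
    _ ≤ 2 * ((∫⁻ x in s, ‖p x - c‖ₑ ^ (3 / 2 : ℝ)) + ∫⁻ x in s, ‖p x - c‖ₑ ^ (3 / 2 : ℝ)) := by
        gcongr
    _ = 4 * ∫⁻ x in s, ‖p x - c‖ₑ ^ (3 / 2 : ℝ) := by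
        rw [← two_mul, ← mul_assoc]
        norm_num

/-! ### The estimate at unit scale -/

/-- Volume of a ball of `ℝ³` in terms of the unit ball. [folklore] -/
theorem volume_ball_eq_ofReal_mul (a : EuclideanSpace ℝ (Fin 3)) {r : ℝ} (hr : 0 ≤ r) :
    volume (ball a r) = ENNReal.ofReal (r ^ 3) * volume (ball (0 : EuclideanSpace ℝ (Fin 3)) 1) := by
  rw [Measure.addHaar_ball volume a hr, finrank_euclideanSpace_fin]

set_option maxHeartbeats 800000 in
-- the duality bound assembles several long statements; the bump covers this proof only
/-- **The local pressure oscillation estimate on one slice, unit scale** (Robinson–Rodrigo–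
Sadowski 2016, Lemma 15.12 in the slice-wise form of p. 234, with `ρ = 1`). There is an absolute
constant `C` such that: if `p ∈ L^{3/2}(B_1(a))`, `u ∈ L³(B_1(a))` (a.e.-strongly measurable on
the ball) satisfy `∫ p Δφ = -∫ D²φ(u, u)` for every test function `φ` supported in `B_1(a)` (the
pressure equation `-Δp = ∂ᵢ∂ⱼ(uᵢuⱼ)` in `𝒟'(B_1(a))`), then for `0 < r ≤ 1/2`
`∫_{B_r} |p - (p)_r|^{3/2} ≤ C [∫_{B_{2r}} |u|³ + r^{9/2} (∫_{2r<|y-a|<1} |u|²|y-a|⁻⁴)^{3/2}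
  + r^{9/2} ∫_{B_1} (|u|³ + |p|^{3/2})]`.
Proof: the bound for one test function (`abs_setIntegral_pressure_sub_const_mul_le`), Hölder
`‖ψ‖₁ ≤ |B_r|^{2/3} ‖ψ‖₃`, the converse of Hölder's inequality
(`FunctionSpaces.lintegral_rpow_enorm_le_of_forall_test`) for `p - c` on `B_r`, and the
replacement of `c` by the mean (`setLIntegral_rpow_sub_average_le_of_const`); `|B_r|^{2/3·3/2} r^{3/2} = |B_1| r^{9/2}`
produces the printed powers. [cite: RobinsonRodrigoSadowski2016, Lemma 15.12 pp. 232–234] -/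
theorem setLIntegral_pressure_oscillation_le_unitScale :
    ∃ C : ℝ≥0, ∀ (a : EuclideanSpace ℝ (Fin 3)) (r : ℝ) (p : EuclideanSpace ℝ (Fin 3) → ℝ)
      (u : EuclideanSpace ℝ (Fin 3) → EuclideanSpace ℝ (Fin 3)), 0 < r → r ≤ 1 / 2 →
      AEStronglyMeasurable p (volume.restrict (ball a 1)) →
      AEStronglyMeasurable u (volume.restrict (ball a 1)) →
      ∫⁻ x in ball a 1, ‖p x‖ₑ ^ (3 / 2 : ℝ) < ⊤ →
      ∫⁻ x in ball a 1, ‖u x‖ₑ ^ (3 : ℕ) < ⊤ →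
      (∀ φ : EuclideanSpace ℝ (Fin 3) → ℝ, ContDiff ℝ (⊤ : ℕ∞) φ → HasCompactSupport φ →
        tsupport φ ⊆ ball a 1 →
        ∫ x, p x * (Δ φ) x = -∫ x, fderiv ℝ (fderiv ℝ φ) x (u x) (u x)) →
      ∫⁻ x in ball a r, ‖p x - ⨍ y in ball a r, p y‖ₑ ^ (3 / 2 : ℝ) ≤
        C * ((∫⁻ x in ball a (2 * r), ‖u x‖ₑ ^ (3 : ℕ)) +
          ENNReal.ofReal (r ^ (9 / 2 : ℝ)) *
            (∫⁻ y in {y | 2 * r < dist y a ∧ dist y a < 1},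
              ‖u y‖ₑ ^ 2 / ENNReal.ofReal (dist y a ^ 4)) ^ (3 / 2 : ℝ) +
          ENNReal.ofReal (r ^ (9 / 2 : ℝ)) *
            ∫⁻ x in ball a 1, (‖u x‖ₑ ^ (3 : ℕ) + ‖p x‖ₑ ^ (3 / 2 : ℝ))) := by
  -- ### constants
  obtain ⟨C₃, hC₃⟩ := stein1970_hessian_Lp_bound_holds_fin3.hessian_newtonNearPotential_half
    (p := 3) (by norm_num) (by norm_num)
  have h₀ : (0 : ℝ) < (1 / 4 : ℝ) / 2 := by norm_num
  have h₁ : (1 / 4 : ℝ) / 2 < 1 / 4 := by norm_num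
  obtain ⟨CH, hCH0, hCH⟩ := exists_abs_newtonNearHess_sub_le h₀ h₁
  obtain ⟨L, hL⟩ := exists_lipschitzWith_newtonFarLaplacian h₀ h₁
  set V₁ : ℝ≥0∞ := volume (ball (0 : EuclideanSpace ℝ (Fin 3)) 1) with hV₁
  have hV₁t : V₁ ≠ ⊤ := measure_ball_lt_top.ne
  set Cₑ : ℝ≥0∞ := 16 * ((9 * (C₃ : ℝ≥0∞)) ^ (3 / 2 : ℝ) +
      ENNReal.ofReal ((L : ℝ) ^ (3 / 2 : ℝ)) * V₁ * V₁ ^ (1 / 2 : ℝ) +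
      ENNReal.ofReal (CH ^ (3 / 2 : ℝ)) * V₁) with hCₑ
  have hCₑt : Cₑ ≠ ⊤ := by
    refine ENNReal.mul_ne_top (by norm_num) (ENNReal.add_ne_top.2 ⟨ENNReal.add_ne_top.2 ⟨?_, ?_⟩, ?_⟩)
    · exact ENNReal.rpow_ne_top_of_nonneg (by norm_num) (ENNReal.mul_ne_top (by norm_num) ENNReal.coe_ne_top)
    · exact ENNReal.mul_ne_top (ENNReal.mul_ne_top ENNReal.ofReal_ne_top hV₁t)
        (ENNReal.rpow_ne_top_of_nonneg (by norm_num) hV₁t)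
    · exact ENNReal.mul_ne_top ENNReal.ofReal_ne_top hV₁t
  refine ⟨Cₑ.toNNReal, fun a r p u hr hr2 hpm hum hp32 hu3 hid => ?_⟩
  rw [ENNReal.coe_toNNReal hCₑt]
  -- ### the data at this `a`, `r`
  set B₁ : Set (EuclideanSpace ℝ (Fin 3)) := ball a 1 with hB₁
  set B₂ : Set (EuclideanSpace ℝ (Fin 3)) := ball a (2 * r) with hB₂
  set D : Set (EuclideanSpace ℝ (Fin 3)) := B₁ \ B₂ with hD
  haveI hfin : IsFiniteMeasure (volume.restrict B₁) :=
    ⟨by rw [Measure.restrict_apply_univ]; exact measure_ball_lt_top⟩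
  have h32t : (3 / 2 : ℝ≥0∞) ≠ ⊤ := by finiteness
  have h320 : (3 / 2 : ℝ≥0∞) ≠ 0 := (ENNReal.div_pos (by norm_num) ENNReal.ofNat_ne_top).ne'
  have h32 : (1 : ℝ≥0∞) ≤ 3 / 2 := by
    rw [ENNReal.le_div_iff_mul_le (Or.inl two_ne_zero) (Or.inl ENNReal.ofNat_ne_top)]
    norm_num
  have hp32' : MemLp p (3 / 2 : ℝ≥0∞) (volume.restrict B₁) := by
    refine ⟨hpm, ?_⟩
    rw [eLpNorm_eq_lintegral_rpow_enorm_toReal h320 h32t]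
    refine ENNReal.rpow_lt_top_of_nonneg (by norm_num) (lt_top_iff_ne_top.1 ?_)
    convert hp32 using 3
    norm_num
  have hpi : IntegrableOn p B₁ volume := hp32'.integrable h32
  have hu3' : MemLp u 3 (volume.restrict B₁) := by
    refine ⟨hum, ?_⟩
    rw [eLpNorm_eq_lintegral_rpow_enorm_toReal (by norm_num) (by norm_num)]
    refine ENNReal.rpow_lt_top_of_nonneg (by norm_num) (lt_top_iff_ne_top.1 ?_)
    convert hu3 using 3 with x
    rw [ENNReal.toReal_ofNat, show (3 : ℝ) = ((3 : ℕ) : ℝ) by norm_num, ENNReal.rpow_natCast]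
  have hu2 : IntegrableOn (fun x => ‖u x‖ ^ 2) B₁ volume := by
    have h2 : MemLp u 2 (volume.restrict B₁) := hu3'.mono_exponent (by norm_num)
    have := h2.integrable_norm_pow two_ne_zero
    simpa [IntegrableOn] using this
  -- the constant and the real quantities
  set P₁ : ℝ := ∫ y in B₁, |p y| with hP₁
  set W : ℝ := ∫ y in D, ‖u y‖ ^ 2 / ‖y - a‖ ^ 4 with hW
  set U : ℝ≥0∞ := ∫⁻ x in B₂, ‖u x‖ₑ ^ (3 : ℕ) with hU
  set c : ℝ := (∫ y in B₁, p y * newtonFarLaplacian ((1 / 4 : ℝ) / 2) (1 / 4) (y - a)) -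
    ∫ y in D, newtonNearHess ((1 / 4 : ℝ) / 2) (1 / 4) (u y) (u y) (y - a) with hc
  have hP₁0 : 0 ≤ P₁ := integral_nonneg fun y => abs_nonneg _
  have hW0 : 0 ≤ W := integral_nonneg fun y => by positivity
  have hUt : U ≠ ⊤ := ((lintegral_mono_set (ball_subset_ball (by linarith) : B₂ ⊆ B₁)).trans_lt hu3).ne
  set Vr : ℝ≥0∞ := volume (ball a r) with hVr
  have hVrt : Vr ≠ ⊤ := measure_ball_lt_top.ne
  have hVr0 : Vr ≠ 0 := (measure_ball_pos volume a hr).ne'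
  have hVreq : Vr = ENNReal.ofReal (r ^ 3) * V₁ := volume_ball_eq_ofReal_mul a hr.le
  set K₁ : ℝ≥0∞ := ENNReal.ofReal (L * r * P₁) * Vr ^ (2 / 3 : ℝ) with hK₁
  set K₂ : ℝ≥0∞ := 9 * C₃ * U ^ (2 / 3 : ℝ) with hK₂
  set K₃ : ℝ≥0∞ := ENNReal.ofReal (CH * r * W) * Vr ^ (2 / 3 : ℝ) with hK₃
  have hK₁t : K₁ ≠ ⊤ :=
    ENNReal.mul_ne_top ENNReal.ofReal_ne_top (ENNReal.rpow_ne_top_of_nonneg (by norm_num) hVrt)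
  have hK₂t : K₂ ≠ ⊤ :=
    ENNReal.mul_ne_top (ENNReal.mul_ne_top (by norm_num) ENNReal.coe_ne_top)
      (ENNReal.rpow_ne_top_of_nonneg (by norm_num) hUt)
  have hK₃t : K₃ ≠ ⊤ :=
    ENNReal.mul_ne_top ENNReal.ofReal_ne_top (ENNReal.rpow_ne_top_of_nonneg (by norm_num) hVrt)
  set K : ℝ≥0∞ := K₁ + K₂ + K₃ with hK
  have hKt : K ≠ ⊤ := ENNReal.add_ne_top.2 ⟨ENNReal.add_ne_top.2 ⟨hK₁t, hK₂t⟩, hK₃t⟩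
  -- ### the bound for one test function
  have hbound : ∀ Ψ : EuclideanSpace ℝ (Fin 3) → ℝ, ContDiff ℝ (⊤ : ℕ∞) Ψ → HasCompactSupport Ψ →
      tsupport Ψ ⊆ ball a r →
      |∫ x in ball a r, (p x - c) * Ψ x| ≤ K.toReal * (eLpNorm Ψ (ENNReal.ofReal 3) volume).toReal := by
    intro Ψ hΨ hΨc hΨs
    have hL4 := abs_setIntegral_pressure_sub_const_mul_le hC₃ hCH0 hCH hL hr hr2 hum hpi hu2 hu3 hid
      hΨ hΨc hΨs
    -- the `L³` and `L¹` norms of `Ψ`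
    have hΨcont : Continuous Ψ := hΨ.continuous
    set n₃ : ℝ≥0∞ := (∫⁻ x, ‖Ψ x‖ₑ ^ (3 : ℝ)) ^ (1 / 3 : ℝ) with hn₃
    have hn₃eq : eLpNorm Ψ (ENNReal.ofReal 3) volume = n₃ := by
      rw [show ENNReal.ofReal 3 = 3 by norm_num,
        eLpNorm_eq_lintegral_rpow_enorm_toReal (by norm_num) (by norm_num), ENNReal.toReal_ofNat]
    have hn₃t : n₃ ≠ ⊤ := by
      rw [← hn₃eq]; exact (hΨcont.memLp_of_hasCompactSupport hΨc).eLpNorm_ne_top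
    have hΨ0 : ∀ x, x ∉ ball a r → Ψ x = 0 := fun x hx =>
      image_eq_zero_of_notMem_tsupport fun h => hx (hΨs h)
    have hI : ∫ x, |Ψ x| ≤ (Vr ^ (2 / 3 : ℝ)).toReal * n₃.toReal := by
      have hH := setLIntegral_rpow_le_rpow_mul_measure volume (ball a r)
        (F := fun x => ‖Ψ x‖ₑ) (hΨcont.aestronglyMeasurable.enorm) (a := 1) (b := 3) one_pos
        (by norm_num)
      simp only [ENNReal.rpow_one] at hH
      have e1 : ∫ x, |Ψ x| = (∫⁻ x in ball a r, ‖Ψ x‖ₑ).toReal := by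
        rw [← setIntegral_eq_integral_of_forall_compl_eq_zero (s := ball a r)
          (fun x hx => by rw [hΨ0 x hx, abs_zero]), integral_eq_lintegral_of_nonneg_ae
          (Eventually.of_forall fun x => abs_nonneg _) hΨcont.abs.aestronglyMeasurable]
        congr 1
        refine lintegral_congr_ae (Eventually.of_forall fun x => ?_)
        simp only [Real.enorm_eq_ofReal_abs]
      have e2 : (∫⁻ x in ball a r, ‖Ψ x‖ₑ ^ (3 : ℝ)) ^ (1 / 3 : ℝ) ≤ n₃ :=
        ENNReal.rpow_le_rpow (lintegral_mono_set (subset_univ _) |>.trans_eq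
          (by rw [Measure.restrict_univ])) (by norm_num)
      rw [e1, ← ENNReal.toReal_mul]
      refine ENNReal.toReal_mono (ENNReal.mul_ne_top (ENNReal.rpow_ne_top_of_nonneg (by norm_num)
        hVrt) hn₃t) ?_
      calc ∫⁻ x in ball a r, ‖Ψ x‖ₑ ≤ (∫⁻ x in ball a r, ‖Ψ x‖ₑ ^ (3 : ℝ)) ^ (1 / 3 : ℝ) *
            Vr ^ (1 - 1 / 3 : ℝ) := hH
        _ ≤ n₃ * Vr ^ (2 / 3 : ℝ) := by
            rw [show (1 - 1 / 3 : ℝ) = 2 / 3 by norm_num]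
            gcongr
        _ = Vr ^ (2 / 3 : ℝ) * n₃ := mul_comm _ _
    -- the three coefficients in real form
    have hVr23t : Vr ^ (2 / 3 : ℝ) ≠ ⊤ := ENNReal.rpow_ne_top_of_nonneg (by norm_num) hVrt
    have hK₁r : K₁.toReal = L * r * P₁ * (Vr ^ (2 / 3 : ℝ)).toReal := by
      rw [hK₁, ENNReal.toReal_mul, ENNReal.toReal_ofReal (by positivity)]
    have hK₂r : (9 * C₃ * n₃ * U ^ (2 / 3 : ℝ)).toReal = K₂.toReal * n₃.toReal := by
      rw [hK₂, ← ENNReal.toReal_mul]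
      congr 1
      ring
    have hK₃r : K₃.toReal = CH * r * W * (Vr ^ (2 / 3 : ℝ)).toReal := by
      rw [hK₃, ENNReal.toReal_mul, ENNReal.toReal_ofReal (by positivity)]
    have hKr : K.toReal = K₁.toReal + K₂.toReal + K₃.toReal := by
      rw [hK, ENNReal.toReal_add (ENNReal.add_ne_top.2 ⟨hK₁t, hK₂t⟩) hK₃t,
        ENNReal.toReal_add hK₁t hK₂t]
    rw [hn₃eq]
    refine hL4.trans ?_
    have hn₃0 : 0 ≤ n₃.toReal := ENNReal.toReal_nonneg
    have hV0 : 0 ≤ (Vr ^ (2 / 3 : ℝ)).toReal := ENNReal.toReal_nonneg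
    have hT₁ : (L * r * ∫ x, |Ψ x|) * P₁ ≤ K₁.toReal * n₃.toReal := by
      rw [hK₁r]
      have : (L : ℝ) * r * (∫ x, |Ψ x|) * P₁ ≤ L * r * ((Vr ^ (2 / 3 : ℝ)).toReal * n₃.toReal) * P₁ := by
        gcongr
      nlinarith [this]
    have hT₃ : (CH * r * ∫ x, |Ψ x|) * W ≤ K₃.toReal * n₃.toReal := by
      rw [hK₃r]
      have : CH * r * (∫ x, |Ψ x|) * W ≤ CH * r * ((Vr ^ (2 / 3 : ℝ)).toReal * n₃.toReal) * W := by
        gcongr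
      nlinarith [this]
    rw [hK₂r, hKr]
    nlinarith [hT₁, hT₃, mul_nonneg (ENNReal.toReal_nonneg : 0 ≤ K₂.toReal) hn₃0]
  -- ### duality: `∫⁻_{B_r} |p - c|^{3/2} ≤ K^{3/2}`
  have hES : IntegrableOn (fun x => p x - c) (ball a r) volume :=
    (hpi.mono_set (ball_subset_ball (by linarith))).sub (integrableOn_const hVrt)
  have hpq : Real.HolderConjugate (3 / 2) 3 := Real.holderConjugate_iff.2 ⟨by norm_num, by norm_num⟩
  have key := FunctionSpaces.lintegral_rpow_enorm_le_of_forall_test (μ := volume) isOpen_ball hES hpq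
    (M := K.toReal) ENNReal.toReal_nonneg hbound
  have key' : ∫⁻ x in ball a r, ‖p x - c‖ₑ ^ (3 / 2 : ℝ) ≤ K ^ (3 / 2 : ℝ) := by
    refine key.trans (le_of_eq ?_)
    rw [← ENNReal.ofReal_rpow_of_nonneg ENNReal.toReal_nonneg (by norm_num), ENNReal.ofReal_toReal hKt]
  -- ### the mean instead of the constant
  have hmean := setLIntegral_rpow_sub_average_le_of_const hVr0 hVrt
    (hpi.mono_set (ball_subset_ball (by linarith))) c
  -- ### the powers of the three coefficients
  have hK₂p : K₂ ^ (3 / 2 : ℝ) = (9 * (C₃ : ℝ≥0∞)) ^ (3 / 2 : ℝ) * U := by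
    rw [hK₂, ENNReal.mul_rpow_of_nonneg _ _ (by norm_num), ← ENNReal.rpow_mul]
    norm_num
  have hVr23p : (Vr ^ (2 / 3 : ℝ)) ^ (3 / 2 : ℝ) = ENNReal.ofReal (r ^ 3) * V₁ := by
    rw [← ENNReal.rpow_mul, ← hVreq]
    norm_num
  have hr92 : ENNReal.ofReal (r ^ (3 / 2 : ℝ)) * ENNReal.ofReal (r ^ 3) = ENNReal.ofReal (r ^ (9 / 2 : ℝ)) := by
    rw [← ENNReal.ofReal_mul (by positivity), ← Real.rpow_natCast,
      ← Real.rpow_add hr]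
    norm_num
  -- `K₁^{3/2} ≤ L^{3/2} |B₁| |B₁|^{1/2} r^{9/2} ∫_{B₁} |p|^{3/2}`
  have hP₁e : ENNReal.ofReal P₁ = ∫⁻ y in B₁, ‖p y‖ₑ := by
    rw [hP₁, ← ofReal_integral_norm_eq_lintegral_enorm hpi]
    rfl
  have hVB₁ : volume B₁ = V₁ := by
    rw [hB₁, hV₁]; exact Measure.addHaar_ball_center volume a 1
  have hP32 : (∫⁻ y in B₁, ‖p y‖ₑ) ^ (3 / 2 : ℝ) ≤ V₁ ^ (1 / 2 : ℝ) * ∫⁻ y in B₁, ‖p y‖ₑ ^ (3 / 2 : ℝ) := by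
    have h := lintegral_enorm_rpow_threeHalves_le (μ := volume.restrict B₁) (h := p) hpm
    rwa [Measure.restrict_apply_univ, hVB₁] at h
  have hK₁p : K₁ ^ (3 / 2 : ℝ) ≤ ENNReal.ofReal ((L : ℝ) ^ (3 / 2 : ℝ)) * V₁ * V₁ ^ (1 / 2 : ℝ) *
      (ENNReal.ofReal (r ^ (9 / 2 : ℝ)) * ∫⁻ y in B₁, ‖p y‖ₑ ^ (3 / 2 : ℝ)) := by
    rw [hK₁, ENNReal.mul_rpow_of_nonneg _ _ (by norm_num), hVr23p,
      ENNReal.ofReal_rpow_of_nonneg (by positivity) (by norm_num),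
      Real.mul_rpow (by positivity) hP₁0, Real.mul_rpow (by positivity) hr.le,
      ENNReal.ofReal_mul (by positivity), ENNReal.ofReal_mul (by positivity),
      ← ENNReal.ofReal_rpow_of_nonneg hP₁0 (by norm_num), hP₁e]
    calc ENNReal.ofReal ((L : ℝ) ^ (3 / 2 : ℝ)) * ENNReal.ofReal (r ^ (3 / 2 : ℝ)) *
          (∫⁻ y in B₁, ‖p y‖ₑ) ^ (3 / 2 : ℝ) * (ENNReal.ofReal (r ^ 3) * V₁)
        ≤ ENNReal.ofReal ((L : ℝ) ^ (3 / 2 : ℝ)) * ENNReal.ofReal (r ^ (3 / 2 : ℝ)) *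
          (V₁ ^ (1 / 2 : ℝ) * ∫⁻ y in B₁, ‖p y‖ₑ ^ (3 / 2 : ℝ)) * (ENNReal.ofReal (r ^ 3) * V₁) := by
          gcongr
      _ = ENNReal.ofReal ((L : ℝ) ^ (3 / 2 : ℝ)) * V₁ * V₁ ^ (1 / 2 : ℝ) *
          ((ENNReal.ofReal (r ^ (3 / 2 : ℝ)) * ENNReal.ofReal (r ^ 3)) *
            ∫⁻ y in B₁, ‖p y‖ₑ ^ (3 / 2 : ℝ)) := by ring
      _ = _ := by rw [hr92]
  -- `K₃^{3/2} = CH^{3/2} |B₁| r^{9/2} W^{3/2}` and `W` as a lower integral over the open shell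
  set S₂ : Set (EuclideanSpace ℝ (Fin 3)) := {y | 2 * r < dist y a ∧ dist y a < 1} with hS₂
  have hWint : IntegrableOn (fun y => ‖u y‖ ^ 2 / ‖y - a‖ ^ 4) D volume := by
    have hDm : MeasurableSet D := measurableSet_ball.diff measurableSet_ball
    have hDfar : ∀ y ∈ D, 2 * r ≤ ‖y - a‖ := fun y hy => by
      have h2 : y ∉ ball a (2 * r) := hy.2
      rwa [mem_ball_iff_norm, not_lt] at h2
    have hDpos : ∀ y ∈ D, 0 < ‖y - a‖ := fun y hy => by linarith [hDfar y hy]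
    have hcont : ContinuousOn (fun y : EuclideanSpace ℝ (Fin 3) => (‖y - a‖ ^ 4)⁻¹) D := by
      refine ContinuousOn.inv₀ (by fun_prop) fun y hy => ?_
      exact (pow_pos (hDpos y hy) 4).ne'
    have hbd : ∀ᵐ y ∂(volume.restrict D), ‖(‖y - a‖ ^ 4)⁻¹‖ ≤ ((2 * r) ^ 4)⁻¹ := by
      filter_upwards [ae_restrict_mem hDm] with y hy
      rw [norm_inv, norm_pow, norm_norm]
      exact inv_anti₀ (by positivity) (pow_le_pow_left₀ (by positivity) (hDfar y hy) 4)
    have h := (hu2.mono_set sdiff_subset).bdd_mul (hcont.aestronglyMeasurable hDm) hbd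
    refine (h.congr (Eventually.of_forall fun y => ?_))
    simp only [div_eq_mul_inv, mul_comm]
  have hWe : ENNReal.ofReal W = ∫⁻ y in S₂, ‖u y‖ₑ ^ 2 / ENNReal.ofReal (dist y a ^ 4) := by
    rw [hW, ofReal_integral_eq_lintegral_ofReal hWint (Eventually.of_forall fun y => by positivity)]
    -- `D` and `S₂` differ by a sphere
    have hDS : D =ᵐ[volume] S₂ := by
      refine (ae_eq_set).2 ⟨?_, ?_⟩
      · refine measure_mono_null (fun y hy => ?_) (Measure.addHaar_sphere volume a (2 * r))
        obtain ⟨⟨hy1, hy2⟩, hyS⟩ := hy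
        rw [hB₁, mem_ball] at hy1
        rw [hB₂, mem_ball, not_lt] at hy2
        rw [hS₂, mem_setOf_eq, not_and_or, not_lt] at hyS
        rcases hyS with h | h
        · exact mem_sphere.2 (le_antisymm h hy2)
        · exact absurd hy1 h
      · refine measure_mono_null (fun y hy => ?_) (measure_empty (μ := volume))
        obtain ⟨⟨hy1, hy2⟩, hyD⟩ := hy
        exact hyD ⟨by rw [hB₁, mem_ball]; exact hy2, by rw [hB₂, mem_ball, not_lt]; exact hy1.le⟩
    rw [setLIntegral_congr hDS]
    refine lintegral_congr_ae ?_
    filter_upwards [ae_restrict_mem (by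
      rw [hS₂]
      exact (isOpen_lt (continuous_const) (continuous_id.dist continuous_const)).inter
        (isOpen_lt (continuous_id.dist continuous_const) continuous_const) |>.measurableSet)] with y hy
    have hy0 : 0 < dist y a := by
      have : 2 * r < dist y a := hy.1
      nlinarith
    rw [ENNReal.ofReal_div_of_pos (by positivity), ← dist_eq_norm, ENNReal.ofReal_pow (norm_nonneg _),
      ofReal_norm]
  have hK₃p : K₃ ^ (3 / 2 : ℝ) = ENNReal.ofReal (CH ^ (3 / 2 : ℝ)) * V₁ *
      (ENNReal.ofReal (r ^ (9 / 2 : ℝ)) *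
        (∫⁻ y in S₂, ‖u y‖ₑ ^ 2 / ENNReal.ofReal (dist y a ^ 4)) ^ (3 / 2 : ℝ)) := by
    rw [hK₃, ENNReal.mul_rpow_of_nonneg _ _ (by norm_num), hVr23p,
      ENNReal.ofReal_rpow_of_nonneg (by positivity) (by norm_num),
      Real.mul_rpow (by positivity) hW0, Real.mul_rpow hCH0 hr.le,
      ENNReal.ofReal_mul (by positivity), ENNReal.ofReal_mul (by positivity),
      ← ENNReal.ofReal_rpow_of_nonneg hW0 (by norm_num), hWe, ← hr92]
    ring
  -- ### assembly
  have hsum : K ^ (3 / 2 : ℝ) ≤ 4 * (K₁ ^ (3 / 2 : ℝ) + K₂ ^ (3 / 2 : ℝ) + K₃ ^ (3 / 2 : ℝ)) := by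
    calc K ^ (3 / 2 : ℝ) = ((K₁ + K₂) + K₃) ^ (3 / 2 : ℝ) := by rw [hK]
      _ ≤ 2 * ((K₁ + K₂) ^ (3 / 2 : ℝ) + K₃ ^ (3 / 2 : ℝ)) := rpow_threeHalves_add_le_two_mul _ _
      _ ≤ 2 * (2 * (K₁ ^ (3 / 2 : ℝ) + K₂ ^ (3 / 2 : ℝ)) + K₃ ^ (3 / 2 : ℝ)) := by
          gcongr
          exact rpow_threeHalves_add_le_two_mul _ _
      _ ≤ 2 * (2 * (K₁ ^ (3 / 2 : ℝ) + K₂ ^ (3 / 2 : ℝ)) + 2 * K₃ ^ (3 / 2 : ℝ)) := by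
          gcongr
          exact le_mul_of_one_le_left zero_le one_le_two
      _ = 4 * (K₁ ^ (3 / 2 : ℝ) + K₂ ^ (3 / 2 : ℝ) + K₃ ^ (3 / 2 : ℝ)) := by ring
  -- shorthand for the three target quantities
  set X₁ : ℝ≥0∞ := ∫⁻ x in ball a (2 * r), ‖u x‖ₑ ^ (3 : ℕ) with hX₁
  set X₂ : ℝ≥0∞ := ENNReal.ofReal (r ^ (9 / 2 : ℝ)) *
      (∫⁻ y in S₂, ‖u y‖ₑ ^ 2 / ENNReal.ofReal (dist y a ^ 4)) ^ (3 / 2 : ℝ) with hX₂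
  set X₃ : ℝ≥0∞ := ENNReal.ofReal (r ^ (9 / 2 : ℝ)) *
      ∫⁻ x in ball a 1, (‖u x‖ₑ ^ (3 : ℕ) + ‖p x‖ₑ ^ (3 / 2 : ℝ)) with hX₃
  set A₁ : ℝ≥0∞ := (9 * (C₃ : ℝ≥0∞)) ^ (3 / 2 : ℝ) with hA₁
  set A₂ : ℝ≥0∞ := ENNReal.ofReal ((L : ℝ) ^ (3 / 2 : ℝ)) * V₁ * V₁ ^ (1 / 2 : ℝ) with hA₂
  set A₃ : ℝ≥0∞ := ENNReal.ofReal (CH ^ (3 / 2 : ℝ)) * V₁ with hA₃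
  have hX₃' : ENNReal.ofReal (r ^ (9 / 2 : ℝ)) * ∫⁻ y in B₁, ‖p y‖ₑ ^ (3 / 2 : ℝ) ≤ X₃ := by
    rw [hX₃, hB₁]
    gcongr with x
    exact le_add_self
  calc ∫⁻ x in ball a r, ‖p x - ⨍ y in ball a r, p y‖ₑ ^ (3 / 2 : ℝ)
      ≤ 4 * ∫⁻ x in ball a r, ‖p x - c‖ₑ ^ (3 / 2 : ℝ) := hmean
    _ ≤ 4 * (4 * (K₁ ^ (3 / 2 : ℝ) + K₂ ^ (3 / 2 : ℝ) + K₃ ^ (3 / 2 : ℝ))) := by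
        gcongr
        exact key'.trans hsum
    _ ≤ 4 * (4 * (A₂ * X₃ + A₁ * X₁ + A₃ * X₂)) := by
        gcongr
        · exact hK₁p.trans (mul_le_mul_right hX₃' _)
        · exact hK₂p.le
        · exact hK₃p.le
    _ ≤ Cₑ * (X₁ + X₂ + X₃) := by
        rw [hCₑ]
        have h16 : (4 : ℝ≥0∞) * 4 = 16 := by norm_num
        calc 4 * (4 * (A₂ * X₃ + A₁ * X₁ + A₃ * X₂)) = 16 * (A₂ * X₃ + A₁ * X₁ + A₃ * X₂) := by
              rw [← mul_assoc, h16]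
          _ ≤ 16 * ((A₁ + A₂ + A₃) * X₃ + (A₁ + A₂ + A₃) * X₁ + (A₁ + A₂ + A₃) * X₂) := by
              gcongr
              · exact le_add_of_le_of_nonneg le_add_self zero_le
              · exact (le_add_right le_rfl).trans (le_add_right le_rfl)
              · exact le_add_self
          _ = 16 * (A₁ + A₂ + A₃) * (X₁ + X₂ + X₃) := by ring


end Literature.Analysis.FluidPDE

end
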